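import Mathlib.Data.Real.Basic
import Literature.AlgebraicGeometry.Frobenioids.PadicLocalDiscreteValuation
import Literature.AlgebraicGeometry.Frobenioids.PadicFrobenioidZero
import HarnessLib

/-!
# Frobenioids II, Example 1.1 (i): `ord(𝒪_K^▷) ≅ ord(𝒪_{K'}^▷)` over `ord(p)` from equal value groups (PROOFS)

Mochizuki, *The geometry of Frobenioids II*, Kyushu J. Math. **62** (2008), §1, Example 1.1 (i) p. 7
[cite: MochizukiFrdII2008, Ex 1.1 (i) p.7]: for `Spec K ∈ Ob(D₀)` the monoid `ord(𝒪_K^▷) := 𝒪_K^▷/𝒪_K^×` depends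
only on the VALUE GROUP of `K` — two `p`-adic valued fields whose valuations are read through "norm-like" maps
`N_K : K → ℝ`, `N_{K'} : K' → ℝ` (`x ≤ᵥ y ↔ N x ≤ N y`, multiplicative, `N 1 = 1`) taking the same value at `p` and
having the same sets of values on nonzero elements have isomorphic monoids `ord(𝒪_K^▷) ≅ ord(𝒪_{K'}^▷)` by an
isomorphism carrying `ord(p) ↦ ord(p)` (the class of `x` is determined by `N x`; match classes of equal value).

PROOF-ONLY (abc-iut cell, seat abc-iut-L5-t16 gen 6; the monoid-theoretic half of the ramification clause `hbaseRam`
of [IUTchI] Ex. 3.3 (iii) (d), row E33iii/d-hram): 0 definitions, no new Prop fact; elementary; nothing here bears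
on [IUTchIII] Cor. 3.12.
-/

namespace Literature.AlgebraicGeometry.Frobenioids

namespace PadicFrd

open ValuativeRel

universe u

section NormLike

variable {K : Type u} [Field K] [ValuativeRel K] {N : K → ℝ}

/-- Reading the valuation through a norm-like map `N` (`x ≤ᵥ y ↔ N x ≤ N y`): `v(a) ≤ v(b) ↔ N a ≤ N b`.
[cite: MochizukiFrdII2008, Ex 1.1 (i) p.7] -/
theorem valuation_le_iff_of_normLike (hN : ∀ a b : K, a ≤ᵥ b ↔ N a ≤ N b) (a b : K) :
    valuation K a ≤ valuation K b ↔ N a ≤ N b := by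
  rw [← Valuation.Compatible.vle_iff_le]
  exact hN a b

/-- `v(a) = v(b) ↔ N a = N b`. [cite: MochizukiFrdII2008, Ex 1.1 (i) p.7] -/
theorem valuation_eq_iff_of_normLike (hN : ∀ a b : K, a ≤ᵥ b ↔ N a ≤ N b) (a b : K) :
    valuation K a = valuation K b ↔ N a = N b := by
  constructor
  · intro h
    exact le_antisymm ((valuation_le_iff_of_normLike hN a b).mp h.le)
      ((valuation_le_iff_of_normLike hN b a).mp h.ge)
  · intro h
    exact le_antisymm ((valuation_le_iff_of_normLike hN a b).mpr h.le)
      ((valuation_le_iff_of_normLike hN b a).mpr h.ge)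

/-- Two classes of `ord(𝒪_K^▷)` coincide iff the norms coincide. [cite: MochizukiFrdII2008, Ex 1.1 (i) p.7] -/
theorem associatesMk_eq_iff_of_normLike (hN : ∀ a b : K, a ≤ᵥ b ↔ N a ≤ N b) (x y : intNonzero K) :
    Associates.mk x = Associates.mk y ↔ N (x : K) = N (y : K) := by
  rw [associatesMk_eq_iff_valuation_eq, valuation_eq_iff_of_normLike hN]

/-- Membership in `𝒪_K^▷` read through `N` (`N 1 = 1`): `N a ≤ 1` and `a ≠ 0`. [cite: MochizukiFrdII2008, Ex 1.1 (i) p.7] -/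
theorem mem_intNonzero_iff_of_normLike (hN : ∀ a b : K, a ≤ᵥ b ↔ N a ≤ N b) (h1 : N 1 = 1) {a : K} :
    a ∈ intNonzero K ↔ N a ≤ 1 ∧ a ≠ 0 := by
  rw [mem_intNonzero_iff, ← (valuation K).map_one, valuation_le_iff_of_normLike hN, h1]

/-- Every class of `ord(𝒪_K^▷)` is the class of its chosen representative. [cite: MochizukiFrdII2008, Ex 1.1 (i) p.7] -/
theorem associatesMk_out (α : OrdInt K) : Associates.mk (Quotient.out α) = α := by
  rw [← Associates.quotient_mk_eq_mk]
  exact Quotient.out_eq α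

end NormLike

namespace PadicFld

variable {p : ℕ}

/-- **`ord(𝒪_K^▷) ≅ ord(𝒪_{K'}^▷)` over `ord(p)` from equal value groups.**  Let `Spec K`, `Spec K'` be objects of
`D₀` whose valuations are read through norm-like maps `N`, `N'` into `ℝ` (`x ≤ᵥ y ↔ N x ≤ N y`, multiplicative,
`N 1 = 1`) with `N(p) = N'(p)` and the same sets of values on nonzero elements.  Then there is an isomorphism of
monoids `ord(𝒪_K^▷) ≅ ord(𝒪_{K'}^▷)` carrying the class of `p` to the class of `p` (classes are matched by equal
value; classes are determined by their values). [cite: MochizukiFrdII2008, Ex 1.1 (i) p.7] -/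
theorem exists_ordInt_mulEquiv_of_normLike (X Y : PadicFld.{u} p) (NX : X.K → ℝ) (NY : Y.K → ℝ)
    (hX : ∀ a b : X.K, a ≤ᵥ b ↔ NX a ≤ NX b) (hY : ∀ a b : Y.K, a ≤ᵥ b ↔ NY a ≤ NY b)
    (hXm : ∀ a b : X.K, NX (a * b) = NX a * NX b) (hYm : ∀ a b : Y.K, NY (a * b) = NY a * NY b)
    (hX1 : NX 1 = 1) (hY1 : NY 1 = 1) (hpN : NX ((p : ℕ) : X.K) = NY ((p : ℕ) : Y.K))
    (hXY : ∀ a : X.K, a ≠ 0 → ∃ b : Y.K, b ≠ 0 ∧ NY b = NX a)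
    (hYX : ∀ b : Y.K, b ≠ 0 → ∃ a : X.K, a ≠ 0 ∧ NX a = NY b) :
    ∃ ι : OrdInt X.K ≃* OrdInt Y.K,
      ι (Associates.mk ⟨((p : ℕ) : X.K), X.p_mem⟩) = Associates.mk ⟨((p : ℕ) : Y.K), Y.p_mem⟩ := by
  classical
  -- the value of a class
  let jX : OrdInt X.K → ℝ := fun α => NX ((Quotient.out α : intNonzero X.K) : X.K)
  let jY : OrdInt Y.K → ℝ := fun β => NY ((Quotient.out β : intNonzero Y.K) : Y.K)
  have hjX : ∀ a : intNonzero X.K, jX (Associates.mk a) = NX (a : X.K) := fun a =>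
    (associatesMk_eq_iff_of_normLike hX _ _).mp (associatesMk_out (Associates.mk a))
  have hjY : ∀ b : intNonzero Y.K, jY (Associates.mk b) = NY (b : Y.K) := fun b =>
    (associatesMk_eq_iff_of_normLike hY _ _).mp (associatesMk_out (Associates.mk b))
  -- classes are determined by their values
  have hXinj : ∀ α α' : OrdInt X.K, jX α = jX α' → α = α' := fun α α' h => by
    obtain ⟨a, rfl⟩ := Associates.mk_surjective α
    obtain ⟨a', rfl⟩ := Associates.mk_surjective α'
    rw [hjX, hjX] at h
    exact (associatesMk_eq_iff_of_normLike hX a a').mpr h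
  have hYinj : ∀ β β' : OrdInt Y.K, jY β = jY β' → β = β' := fun β β' h => by
    obtain ⟨b, rfl⟩ := Associates.mk_surjective β
    obtain ⟨b', rfl⟩ := Associates.mk_surjective β'
    rw [hjY, hjY] at h
    exact (associatesMk_eq_iff_of_normLike hY b b').mpr h
  -- values are multiplicative
  have hXmul : ∀ α α' : OrdInt X.K, jX (α * α') = jX α * jX α' := fun α α' => by
    obtain ⟨a, rfl⟩ := Associates.mk_surjective α
    obtain ⟨a', rfl⟩ := Associates.mk_surjective α'
    rw [Associates.mk_mul_mk, hjX, hjX, hjX, Submonoid.coe_mul, hXm]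
  have hYmul : ∀ β β' : OrdInt Y.K, jY (β * β') = jY β * jY β' := fun β β' => by
    obtain ⟨b, rfl⟩ := Associates.mk_surjective β
    obtain ⟨b', rfl⟩ := Associates.mk_surjective β'
    rw [Associates.mk_mul_mk, hjY, hjY, hjY, Submonoid.coe_mul, hYm]
  -- equal value sets: every class of `X` has a partner in `Y` and conversely
  have hXsurj : ∀ α : OrdInt X.K, ∃ β : OrdInt Y.K, jY β = jX α := fun α => by
    obtain ⟨a, rfl⟩ := Associates.mk_surjective α
    have ha := (mem_intNonzero_iff_of_normLike hX hX1).mp a.2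
    obtain ⟨b, hb0, hb⟩ := hXY (a : X.K) ha.2
    have hb' : b ∈ intNonzero Y.K := (mem_intNonzero_iff_of_normLike hY hY1).mpr ⟨hb ▸ ha.1, hb0⟩
    exact ⟨Associates.mk ⟨b, hb'⟩, by rw [hjY, hjX]; exact hb⟩
  have hYsurj : ∀ β : OrdInt Y.K, ∃ α : OrdInt X.K, jX α = jY β := fun β => by
    obtain ⟨b, rfl⟩ := Associates.mk_surjective β
    have hb := (mem_intNonzero_iff_of_normLike hY hY1).mp b.2
    obtain ⟨a, ha0, ha⟩ := hYX (b : Y.K) hb.2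
    have ha' : a ∈ intNonzero X.K := (mem_intNonzero_iff_of_normLike hX hX1).mpr ⟨ha ▸ hb.1, ha0⟩
    exact ⟨Associates.mk ⟨a, ha'⟩, by rw [hjX, hjY]; exact ha⟩
  -- the matching of classes of equal value
  let f : OrdInt X.K → OrdInt Y.K := fun α => (hXsurj α).choose
  have hf : ∀ α, jY (f α) = jX α := fun α => (hXsurj α).choose_spec
  let g : OrdInt Y.K → OrdInt X.K := fun β => (hYsurj β).choose
  have hg : ∀ β, jX (g β) = jY β := fun β => (hYsurj β).choose_spec
  let ι : OrdInt X.K ≃* OrdInt Y.K :=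
    { toFun := f, invFun := g,
      left_inv := fun α => hXinj _ _ (by rw [hg, hf]),
      right_inv := fun β => hYinj _ _ (by rw [hf, hg]),
      map_mul' := fun α α' => hYinj _ _ (by rw [hf, hXmul, hYmul, hf, hf]) }
  refine ⟨ι, ?_⟩
  change f _ = _
  apply hYinj
  rw [hf, hjX, hjY]
  exact hpN

end PadicFld

end PadicFrd

end Literature.AlgebraicGeometry.Frobenioids
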